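import Mathlib
import HarnessLib
import HarnessLib.Audit.CruxProbe
import Summits.RiemannHypothesis.Statement
import Summits.RiemannHypothesis.RiemannHypothesis.Theses.SignCone
import Summits.RiemannHypothesis.RiemannHypothesis.Theorems.SignConeSignConeInequalityCriterion
import Summits.RiemannHypothesis.RiemannHypothesis.Theorems.SignConeSignConeOscillatoryUpToSevenFifths
import Summits.RiemannHypothesis.RiemannHypothesis.Theorems.SignConeCondRungPlattTrudgianTwo
import Summits.RiemannHypothesis.RiemannHypothesis.Theorems.SignConeSignConeFarField

/-!
# Crux strategist r2 — BC7 / implies-summit probes for the ladder rungs (item stmt-RiemannHypothesis-16301)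
Self-contained copies of the rung statements of `StrategistR2Ladder.lean` as CLOSED `Prop`s (the probe wants a `def : Prop`),
each probed with `#h21_crux_probe … summit := Summit.RiemannHypothesis` (P1 outright, P2 vacuity, P3 rigidity, P4, P5 `C → S` /
`S → C`). Expected: every finite rung CLEAN (in particular P5 `crux.implies-summit` must NOT fire); the tails / family statements are
X in costume by explicit two-line proofs (Ladder file), whatever the cheap batteries say.
-/

set_option linter.dupNamespace false

namespace Summit.RiemannHypothesis.RiemannHypothesis.Cruxes.SignConeInequality.StrategistR2.Probe

open Summit.RiemannHypothesis.RiemannHypothesis.Theses.SignCone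

/-- L1 rung T = 3/2 (lowest open cutoff rung; certificate computing). -/
def CutoffRungThreeHalves : Prop :=
  ∀ a : ℝ, 0 < a → a ≤ 3 / 2 → ∀ (k : ℕ) (g : Fin k → ℝ → ℂ), (∀ i, (ContDiff ℝ ((⊤ : ℕ∞) : WithTop ℕ∞) (g i) ∧ HasCompactSupport (g i)) ∧ tsupport (g i) ⊆ Set.Icc (-a) a) → let F : ℝ → ℂ := fun t => ∑ i, MeasureTheory.convolution (g i) (fun u => (starRingEnd ℂ) ((g i) (-u))) (ContinuousLinearMap.mul ℂ ℂ) MeasureTheory.MeasureSpace.volume t; (∀ n : ℕ, 2 ≤ n → 0 ≤ (F (Real.log n)).re) → let M : ℂ → ℂ := fun s => ∫ u : ℝ, F u * Complex.exp ((s - 1 / 2) * u); -(F 0).re ≤ (M 0 + M 1 + ((1 / (2 * Real.pi) : ℂ) * (∫ t : ℝ, M (1 / 2 + t * Complex.I) * ((Complex.digamma (1 / 4 + t / 2 * Complex.I)).re : ℂ)) - F 0 * (Real.log Real.pi : ℂ))).re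

/-- L1 rung T = 2 (PT-conditional frontier; unconditional target of "push T"). -/
def CutoffRungTwo : Prop :=
  ∀ a : ℝ, 0 < a → a ≤ 2 → ∀ (k : ℕ) (g : Fin k → ℝ → ℂ), (∀ i, (ContDiff ℝ ((⊤ : ℕ∞) : WithTop ℕ∞) (g i) ∧ HasCompactSupport (g i)) ∧ tsupport (g i) ⊆ Set.Icc (-a) a) → let F : ℝ → ℂ := fun t => ∑ i, MeasureTheory.convolution (g i) (fun u => (starRingEnd ℂ) ((g i) (-u))) (ContinuousLinearMap.mul ℂ ℂ) MeasureTheory.MeasureSpace.volume t; (∀ n : ℕ, 2 ≤ n → 0 ≤ (F (Real.log n)).re) → let M : ℂ → ℂ := fun s => ∫ u : ℝ, F u * Complex.exp ((s - 1 / 2) * u); -(F 0).re ≤ (M 0 + M 1 + ((1 / (2 * Real.pi) : ℂ) * (∫ t : ℝ, M (1 / 2 + t * Complex.I) * ((Complex.digamma (1 / 4 + t / 2 * Complex.I)).re : ℂ)) - F 0 * (Real.log Real.pi : ℂ))).re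

/-- L1 rung T = log 210 / 2 = the route item SignConeUpTo210 verbatim. -/
def CutoffRung210 : Prop :=
  ∀ a : ℝ, 0 < a → a ≤ Real.log 210 / 2 → ∀ (k : ℕ) (g : Fin k → ℝ → ℂ), (∀ i, (ContDiff ℝ ((⊤ : ℕ∞) : WithTop ℕ∞) (g i) ∧ HasCompactSupport (g i)) ∧ tsupport (g i) ⊆ Set.Icc (-a) a) → let F : ℝ → ℂ := fun t => ∑ i, MeasureTheory.convolution (g i) (fun u => (starRingEnd ℂ) ((g i) (-u))) (ContinuousLinearMap.mul ℂ ℂ) MeasureTheory.MeasureSpace.volume t; (∀ n : ℕ, 2 ≤ n → 0 ≤ (F (Real.log n)).re) → let M : ℂ → ℂ := fun s => ∫ u : ℝ, F u * Complex.exp ((s - 1 / 2) * u); -(F 0).re ≤ (M 0 + M 1 + ((1 / (2 * Real.pi) : ℂ) * (∫ t : ℝ, M (1 / 2 + t * Complex.I) * ((Complex.digamma (1 / 4 + t / 2 * Complex.I)).re : ℂ)) - F 0 * (Real.log Real.pi : ℂ))).re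

/-- L1 tail T = 7/5 (cutoffs beyond the unconditional frontier) — X in costume. -/
def CutoffTailSevenFifths : Prop :=
  ∀ a : ℝ, 0 < a → 7 / 5 < a → ∀ (k : ℕ) (g : Fin k → ℝ → ℂ), (∀ i, (ContDiff ℝ ((⊤ : ℕ∞) : WithTop ℕ∞) (g i) ∧ HasCompactSupport (g i)) ∧ tsupport (g i) ⊆ Set.Icc (-a) a) → let F : ℝ → ℂ := fun t => ∑ i, MeasureTheory.convolution (g i) (fun u => (starRingEnd ℂ) ((g i) (-u))) (ContinuousLinearMap.mul ℂ ℂ) MeasureTheory.MeasureSpace.volume t; (∀ n : ℕ, 2 ≤ n → 0 ≤ (F (Real.log n)).re) → let M : ℂ → ℂ := fun s => ∫ u : ℝ, F u * Complex.exp ((s - 1 / 2) * u); -(F 0).re ≤ (M 0 + M 1 + ((1 / (2 * Real.pi) : ℂ) * (∫ t : ℝ, M (1 / 2 + t * Complex.I) * ((Complex.digamma (1 / 4 + t / 2 * Complex.I)).re : ℂ)) - F 0 * (Real.log Real.pi : ℂ))).re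

/-- L1 family statement ∀ T, X_T — X verbatim up to binder shuffling. -/
def CutoffFamily : Prop :=
  ∀ T : ℝ, ∀ a : ℝ, 0 < a → a ≤ T → ∀ (k : ℕ) (g : Fin k → ℝ → ℂ), (∀ i, (ContDiff ℝ ((⊤ : ℕ∞) : WithTop ℕ∞) (g i) ∧ HasCompactSupport (g i)) ∧ tsupport (g i) ⊆ Set.Icc (-a) a) → let F : ℝ → ℂ := fun t => ∑ i, MeasureTheory.convolution (g i) (fun u => (starRingEnd ℂ) ((g i) (-u))) (ContinuousLinearMap.mul ℂ ℂ) MeasureTheory.MeasureSpace.volume t; (∀ n : ℕ, 2 ≤ n → 0 ≤ (F (Real.log n)).re) → let M : ℂ → ℂ := fun s => ∫ u : ℝ, F u * Complex.exp ((s - 1 / 2) * u); -(F 0).re ≤ (M 0 + M 1 + ((1 / (2 * Real.pi) : ℂ) * (∫ t : ℝ, M (1 / 2 + t * Complex.I) * ((Complex.digamma (1 / 4 + t / 2 * Complex.I)).re : ℂ)) - F 0 * (Real.log Real.pi : ℂ))).re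

/-- L2 rung m = 1 ("OscSingleGap", lowest open gap rung). -/
def GapRungOne : Prop :=
  ∀ a : ℝ, 0 < a → ∀ (k : ℕ) (g : Fin k → ℝ → ℂ), (∀ i, (ContDiff ℝ ((⊤ : ℕ∞) : WithTop ℕ∞) (g i) ∧ HasCompactSupport (g i)) ∧ tsupport (g i) ⊆ Set.Icc (-a) a) → let F : ℝ → ℂ := fun t => ∑ i, MeasureTheory.convolution (g i) (fun u => (starRingEnd ℂ) ((g i) (-u))) (ContinuousLinearMap.mul ℂ ℂ) MeasureTheory.MeasureSpace.volume t; (∀ n : ℕ, 2 ≤ n → 0 ≤ (F (Real.log n)).re) → (∃ s : Finset ℕ, s.card ≤ 1 ∧ ∀ t : ℝ, Real.log 2 ≤ |t| → (F t).re < 0 → ∃ n ∈ s, Real.log n ≤ |t| ∧ |t| < Real.log (n + 1)) → let M : ℂ → ℂ := fun s => ∫ u : ℝ, F u * Complex.exp ((s - 1 / 2) * u); -(F 0).re ≤ (M 0 + M 1 + ((1 / (2 * Real.pi) : ℂ) * (∫ t : ℝ, M (1 / 2 + t * Complex.I) * ((Complex.digamma (1 / 4 + t / 2 * Complex.I)).re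 : ℂ)) - F 0 * (Real.log Real.pi : ℂ))).re

/-- L2 rung m = 2. -/
def GapRungTwo : Prop :=
  ∀ a : ℝ, 0 < a → ∀ (k : ℕ) (g : Fin k → ℝ → ℂ), (∀ i, (ContDiff ℝ ((⊤ : ℕ∞) : WithTop ℕ∞) (g i) ∧ HasCompactSupport (g i)) ∧ tsupport (g i) ⊆ Set.Icc (-a) a) → let F : ℝ → ℂ := fun t => ∑ i, MeasureTheory.convolution (g i) (fun u => (starRingEnd ℂ) ((g i) (-u))) (ContinuousLinearMap.mul ℂ ℂ) MeasureTheory.MeasureSpace.volume t; (∀ n : ℕ, 2 ≤ n → 0 ≤ (F (Real.log n)).re) → (∃ s : Finset ℕ, s.card ≤ 2 ∧ ∀ t : ℝ, Real.log 2 ≤ |t| → (F t).re < 0 → ∃ n ∈ s, Real.log n ≤ |t| ∧ |t| < Real.log (n + 1)) → let M : ℂ → ℂ := fun s => ∫ u : ℝ, F u * Complex.exp ((s - 1 / 2) * u); -(F 0).re ≤ (M 0 + M 1 + ((1 / (2 * Real.pi) : ℂ) * (∫ t : ℝ, M (1 / 2 + t * Complex.I) * ((Complex.digamma (1 / 4 +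 t / 2 * Complex.I)).re : ℂ)) - F 0 * (Real.log Real.pi : ℂ))).re

/-- L2 rung m = 54 (dominates cutoff 2). -/
def GapRungFiftyFour : Prop :=
  ∀ a : ℝ, 0 < a → ∀ (k : ℕ) (g : Fin k → ℝ → ℂ), (∀ i, (ContDiff ℝ ((⊤ : ℕ∞) : WithTop ℕ∞) (g i) ∧ HasCompactSupport (g i)) ∧ tsupport (g i) ⊆ Set.Icc (-a) a) → let F : ℝ → ℂ := fun t => ∑ i, MeasureTheory.convolution (g i) (fun u => (starRingEnd ℂ) ((g i) (-u))) (ContinuousLinearMap.mul ℂ ℂ) MeasureTheory.MeasureSpace.volume t; (∀ n : ℕ, 2 ≤ n → 0 ≤ (F (Real.log n)).re) → (∃ s : Finset ℕ, s.card ≤ 54 ∧ ∀ t : ℝ, Real.log 2 ≤ |t| → (F t).re < 0 → ∃ n ∈ s, Real.log n ≤ |t| ∧ |t| < Real.log (n + 1)) → let M : ℂ → ℂ := fun s => ∫ u : ℝ, F u * Complex.exp ((s - 1 / 2) * u); -(F 0).re ≤ (M 0 + M 1 + ((1 / (2 * Real.pi) : ℂ) * (∫ t : ℝ, M (1 / 2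 + t * Complex.I) * ((Complex.digamma (1 / 4 + t / 2 * Complex.I)).re : ℂ)) - F 0 * (Real.log Real.pi : ℂ))).re

/-- L2 family statement ∀ m, X^{(m)} — X in costume (finite-gap-count lemma). -/
def GapFamily : Prop :=
  ∀ m : ℕ, ∀ a : ℝ, 0 < a → ∀ (k : ℕ) (g : Fin k → ℝ → ℂ), (∀ i, (ContDiff ℝ ((⊤ : ℕ∞) : WithTop ℕ∞) (g i) ∧ HasCompactSupport (g i)) ∧ tsupport (g i) ⊆ Set.Icc (-a) a) → let F : ℝ → ℂ := fun t => ∑ i, MeasureTheory.convolution (g i) (fun u => (starRingEnd ℂ) ((g i) (-u))) (ContinuousLinearMap.mul ℂ ℂ) MeasureTheory.MeasureSpace.volume t; (∀ n : ℕ, 2 ≤ n → 0 ≤ (F (Real.log n)).re) → (∃ s : Finset ℕ, s.card ≤ m ∧ ∀ t : ℝ, Real.log 2 ≤ |t| → (F t).re < 0 → ∃ n ∈ s, Real.log n ≤ |t| ∧ |t| < Real.log (n + 1)) → let M : ℂ → ℂ := fun s => ∫ u : ℝ, F u * Complex.exp ((s - 1 / 2) * u); -(F 0).re ≤ (M 0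 + M 1 + ((1 / (2 * Real.pi) : ℂ) * (∫ t : ℝ, M (1 / 2 + t * Complex.I) * ((Complex.digamma (1 / 4 + t / 2 * Complex.I)).re : ℂ)) - F 0 * (Real.log Real.pi : ℂ))).re

set_option h21.cruxProbe.batteryMs 120000
set_option h21.cruxProbe.totalMs 600000

#h21_crux_probe Summit.RiemannHypothesis.RiemannHypothesis.Cruxes.SignConeInequality.StrategistR2.Probe.CutoffRungThreeHalves summit := Summit.RiemannHypothesis
#h21_crux_probe Summit.RiemannHypothesis.RiemannHypothesis.Cruxes.SignConeInequality.StrategistR2.Probe.CutoffRungTwo summit := Summit.RiemannHypothesis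
#h21_crux_probe Summit.RiemannHypothesis.RiemannHypothesis.Cruxes.SignConeInequality.StrategistR2.Probe.CutoffRung210 summit := Summit.RiemannHypothesis
#h21_crux_probe Summit.RiemannHypothesis.RiemannHypothesis.Cruxes.SignConeInequality.StrategistR2.Probe.CutoffTailSevenFifths summit := Summit.RiemannHypothesis
#h21_crux_probe Summit.RiemannHypothesis.RiemannHypothesis.Cruxes.SignConeInequality.StrategistR2.Probe.CutoffFamily summit := Summit.RiemannHypothesis
#h21_crux_probe Summit.RiemannHypothesis.RiemannHypothesis.Cruxes.SignConeInequality.StrategistR2.Probe.GapRungOne summit := Summit.RiemannHypothesis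
#h21_crux_probe Summit.RiemannHypothesis.RiemannHypothesis.Cruxes.SignConeInequality.StrategistR2.Probe.GapRungTwo summit := Summit.RiemannHypothesis
#h21_crux_probe Summit.RiemannHypothesis.RiemannHypothesis.Cruxes.SignConeInequality.StrategistR2.Probe.GapRungFiftyFour summit := Summit.RiemannHypothesis
#h21_crux_probe Summit.RiemannHypothesis.RiemannHypothesis.Cruxes.SignConeInequality.StrategistR2.Probe.GapFamily summit := Summit.RiemannHypothesis

end Summit.RiemannHypothesis.RiemannHypothesis.Cruxes.SignConeInequality.StrategistR2.Probe
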